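import Literature.MathematicalPhysics.QuantumFieldTheory.Balaban1983to89.T3MinimiserStabilityReduction
import Literature.MathematicalPhysics.QuantumFieldTheory.Balaban1983to89.T3PrintedRegularMinimiser
import Literature.MathematicalPhysics.QuantumFieldTheory.Balaban1983to89.T3OrbitAverage
import Literature.MathematicalPhysics.QuantumFieldTheory.Balaban1983to89.B12ContinuousTransportInvariance
import Literature.MathematicalPhysics.QuantumFieldTheory.Balaban1983to89.Node00.CanonicalTransportOfRecord
import HarnessLib

/-!
# LINE g21-3 «interior_table» — THE ONE-LOOP TABLE READ ON THE INTERIOR WINDOW (1L4ᶜ∘ → H4ᶜ∘ → LFR♯ᶜ∘ → S2β), with the `b₀ ∕ c` INSTANTIATION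
# KERNEL-CHECKED (ideator `ym-r3-idea-1` g21, LENS «control»; after ROW R3-FLIN j337502 and ★★OWNER WORD 81 (3)(b)(c))

Crux of record: `stmt-QuantumFields-20520` = `Summit.QuantumFields.YangMills.Theses.UnitScaleTilt.FluctuationComparisonRegPrIntL`.  Target concluded BY NAME
here: this file's `FluctuationPartSmall` — the S2β text of the package `Lines/runpair_organ.lean` v15 ∕ registry `Lines/semiclassical_s2beta.lean` v11.2a
§2 (l.395–418) BYTE-IDENTICAL (window `θBal F.L γ b₀ p₀ J`, NO history: S2β never restricts histories), so that in any file seeing both declarations the bridge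
to `…RunPairOrgan.OneLoop.FluctuationPartSmall` is `Iff.rfl`.  The registry is FROZEN (RULING №36) and is NOT touched: this is a published, unregistered
CANDIDATE for the OWNER's verb #3 gate (WORD 81 (3)(b): «your "instantiate at b₀∕c, S2β carries no hist" is a kernel fact to be shown, not argued» — §3 below
shows it; (3)(c): «typing of the fraction so the concluder MATCHES the rows» — §2 below types it).

WHY (R3-FLIN, memo `Cruxes/FluctuationComparisonRegPrIntL/R3-FLIN-DIAGNOSIS-ym-r3-idea-1-g21.md`): in the linearised one-step toy the window-edge forcing
constant is `c_lin(3,4) = 8.56 > 3^{3∕2}` (certified lower bound), i.e. at the smallest admissible block `L = 3` the fibre minimiser over a STAGGERED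
near-edge window datum leaves the next level's window: the boundary layer `BL_J(3) ≠ ∅`, and on it `−log P(hist(b₀) ∣ U) ≍ c·L·p(g_J)²`.  Every row whose
constant is UNIFORM OVER THE FULL WINDOW `W_J(b₀)` for a `hist(b₀)`-relative quantity is exposed AS TYPED at `L = 3` (toy letter, not a refutation) — among
them the table's three rows 1L4ᶜ (T), H4ᶜ, LFR♯ᶜ at full-window quadrilaterals.  S2β itself is IMMUNE (no history).

THE TYPING (answer to WORD 81 (3)(c)).  Each ∘-row reads its WINDOW clauses — every `PlaqSmall (θBal F.L γ · p₀ J) ·`, in hypotheses, quadrilateral data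
and set-builder windows alike — at the profile `c * b₀`, and keeps its HISTORY `histGood F ℰp (θBal F.L γ b₀ p₀) K J` (inside `heightDensityCan`,
`fluctAtCan`, `oneLoopFourPtCan`) at `b₀`; the fraction is bound by ONE SHARED SHAPE per row, `∀ (L : ℕ), ∃ c₀ : ℝ, 0 < c₀ ∧ c₀ ≤ 1 ∧ ∀ (c : ℝ), 0 < c →
c ≤ c₀ → ∃ pS : ℝ, …` — «for every sufficiently small window fraction» — so that rows are CLOSED UNDER SHRINKING `c` BY FIAT (no monotonicity argument is
owed: the mathematics of each row is the same verbatim for any smaller fraction) and a concluder over several rows takes `c := min c₀ᵢ` and reads every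
row at that common `c`.  NOT a private `∃ c` per row (WORD 81: «five unmatched witnesses»).

THE `b₀ ∕ c` INSTANTIATION (answer to WORD 81 (3)(b)), theorem `fluctuationPartSmall_of_interiorTable` (§3, sorry-free): given `L`, take the common `c`;
given S2β's `b₀ > 0`, read the three rows at history profile `b₀' := b₀ ∕ c > 0`: their window is `θBal F.L γ (c * (b₀ ∕ c)) p₀ J`, and `c * (b₀ ∕ c) = b₀`
(`mul_div_cancel₀`) rewrites it to S2β's window `θBal F.L γ b₀ p₀ J` (`simp only [e] at H1 H2 H3`); the registry's composition (v11.2a §2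
`fluctuationPartSmall_of_semiclassicalCan`, verbatim) then runs with the history at `b₀ ∕ c` throughout — `log ρ + β_K S = f¹_{hist(b₀∕c)} + (log ρ −
log g_{hist(b₀∕c)})`, `|Δ²f¹| ≤ |Λ₄| + |Δ²f¹ − Λ₄|`, `κ := min`, `φ := φ₁ + φ₂ + ψ` — because S2β's conclusion never mentions a history.  Equivalently: the
table at window `b₀` with «good histories» up to `θ_j ∕ c`.

HONEST STATUS.  `lean check`: rc 0, errors 0; sorries = the 3 stubs of §4 (1L4ᶜ∘, H4ᶜ∘, LFR♯ᶜ∘) and 0 elsewhere; by-name concluder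
`fluctuationPartSmall_of_stubs : FluctuationPartSmall`.  NOT registered (`ledger skeleton check` is the OWNER's registry verb, frozen); the upstream rows EXW ∕
GAP♯ ∕ DET-REP-B(‴) ∕ WREG that derive 1L4ᶜ in the registry are NOT re-read here (their pens' call; the same two textual moves apply).  Nothing of Bałaban's is
asserted; 1L4ᶜ∘ ∕ H4ᶜ∘ ∕ LFR♯ᶜ∘ ∕ S2β ∕ 20520 are NOT proved; `YM3TorusSU2` is NOT proved; rung R3 — NOT d = 4, NOT infinite volume, NOT a mass gap, NOT Clay.
References: [Balaban1985UV3] (41) p.266, (45)–(47) p.267; [Balaban1985Variational] Thm 1 (8)–(10) p.279; [Balaban1988Convergent] §2; [King1986] Prop. 3.8–3.9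
(the c-interior + tail-at-profile-c·b₀ excision the crux 20520 itself is typed with, `T3InteriorExcision` l.100–116).
-/

open MeasureTheory Filter Topology Set
open Literature.MathematicalPhysics.QuantumFieldTheory.Balaban1983to89
open Literature.MathematicalPhysics.QuantumFieldTheory.Balaban1983to89.T3ContinuumYM3Torus
open Literature.MathematicalPhysics.QuantumFieldTheory.Balaban1983to89.T3NestedUnitLaws
open Literature.MathematicalPhysics.QuantumFieldTheory.Balaban1983to89.T3UnitLawDensityEML
open Literature.MathematicalPhysics.QuantumFieldTheory.Balaban1983to89.T3UnitScaleTilt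
open Literature.MathematicalPhysics.QuantumFieldTheory.Balaban1983to89.T3TiltDescent
open Literature.MathematicalPhysics.QuantumFieldTheory.Balaban1983to89.T3PrintedRegularMinimiser
open Literature.MathematicalPhysics.QuantumFieldTheory.Balaban1983to89.T3ConstrainedMinimiser (fibre)
open Literature.MathematicalPhysics.QuantumFieldTheory.Balaban1983to89.T3LevelShift
open Literature.MathematicalPhysics.QuantumFieldTheory.Balaban1983to89.Missing
open Literature.MathematicalPhysics.QuantumFieldTheory.Balaban1983to89.T4Continuum

noncomputable section

namespace Summit.QuantumFields.YangMills.Cruxes.FluctuationComparisonRegPrIntL.RunPairOrgan.InteriorTable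

/-! ## §0 The canonical version, the connected 4-point, the λ-scaled fluctuation part (verbatim from registry v11.2a §1–§2 ∕ LINE g21-1 §0a–§0b) -/

section Canonical

variable (F : T3Family) (γ : ℝ) {J K : ℕ} (hJK : J ≤ K) (S : Set (GaugeField (F.P K) 0 (Matrix.specialUnitaryGroup (Fin 2) ℂ)))

/-- **THE CANONICAL VERSION OF BAŁABAN'S RESTRICTED DENSITY AT HEIGHT `K − J`** read on the `J`-th tower's finest lattice: the trunk's `heightDensity`
(a chosen Radon–Nikodym version) replaced by `Node00.canonVersion` of its a.e.-class for product Haar — continuous on the maximal open set carrying a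
continuous representative and equal there to every such representative. [cite: Balaban1985UV3, (2) p.256 and (41) p.266] -/
def heightDensityCan (V : GaugeField (F.P J) 0 (Matrix.specialUnitaryGroup (Fin 2) ℂ)) : ℝ :=
  Node00.canonVersion (fieldMeasure (F.P J) 0 (Matrix.specialUnitaryGroup (Fin 2) ℂ)) (heightDensity F γ hJK S) V


end Canonical

section Rows

/-- The connected 4-point (mixed second difference) — verbatim from v3a. [cite: Balaban1985UV3, (41) p.266] -/
def fourPt {X : Type*} (f : X → ℝ) (U V W Z : X) : ℝ := (f U - f V) - (f W - f Z)

variable (F : T3Family) (γ b₀ p₀ ε₀ : ℝ) {J K : ℕ} (hJK : J ≤ K)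

/-- **THE λ-SCALED FLUCTUATION PART OVER THE CANONICAL VERSION** `f^λ(V) := log heightDensityCan F (γ/λ) (histGood at θBal(γ)) V + β_K(γ/λ)·minActionRegPr(V)`.
[cite: Balaban1985UV3, (2) p.256 and (41) p.266] -/
def fluctAtCan (lam : ℝ) (V : GaugeField (F.P J) 0 (Matrix.specialUnitaryGroup (Fin 2) ℂ)) : ℝ :=
  Real.log (heightDensityCan F (γ / lam) hJK (histGood F ℰp (θBal F.L γ b₀ p₀) K J) V)
    + (F.scheme ℰp (γ / lam)).β K * minActionRegPr F J K hJK ε₀ V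

/-- **THE CANONICAL ONE-LOOP 4-POINT** `Λ₄ := lim_{λ→∞} Δ² f^λ` over the canonical version (junk if the limit does not exist; 1L4ᶜ asserts it does).
[cite: Balaban1985Variational, Thm 1 (8)-(10) p.279] -/
def oneLoopFourPtCan (U V W Z : GaugeField (F.P J) 0 (Matrix.specialUnitaryGroup (Fin 2) ℂ)) : ℝ :=
  limUnder atTop (fun lam : ℝ => fourPt (fluctAtCan F γ b₀ p₀ ε₀ hJK lam) U V W Z)

/-- At `λ = 1`: S2β's integrand with the canonical small-history density. [cite: Balaban1985UV3, (41) p.266] -/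
theorem fluctAtCan_one (V : GaugeField (F.P J) 0 (Matrix.specialUnitaryGroup (Fin 2) ℂ)) :
    fluctAtCan F γ b₀ p₀ ε₀ hJK 1 V =
      Real.log (heightDensityCan F γ hJK (histGood F ℰp (θBal F.L γ b₀ p₀) K J) V)
        + (F.scheme ℰp γ).β K * minActionRegPr F J K hJK ε₀ V := by
  simp only [fluctAtCan, div_one]

/-- Whenever the λ-scaled 4-point has SOME limit `a`, the canonical one-loop 4-point equals it. [cite: Balaban1985Variational, Thm 1 (8) p.279] -/
theorem oneLoopFourPtCan_eq_of_tendsto (U V W Z : GaugeField (F.P J) 0 (Matrix.specialUnitaryGroup (Fin 2) ℂ)) {a : ℝ}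
    (h : Tendsto (fun lam : ℝ => fourPt (fluctAtCan F γ b₀ p₀ ε₀ hJK lam) U V W Z) atTop (𝓝 a)) :
    oneLoopFourPtCan F γ b₀ p₀ ε₀ hJK U V W Z = a := by
  unfold oneLoopFourPtCan; exact h.limUnder_eq


/-- **S2β · FLUCTUATION PART SMALL IN 4-POINT CURRENCY** — VERBATIM from the package `Lines/runpair_organ.lean` v15 ∕ registry v11.2a (version-free: it
quantifies over continuous positive versions `ρ`; it restricts NO history). [cite: Balaban1985UV3, Thm 2 p.263 and (41) p.266] -/
def FluctuationPartSmall : Prop :=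
  ∀ (L : ℕ), ∃ pS : ℝ, ∀ (b₀ p₀ : ℝ), 0 < b₀ → pS ≤ p₀ → 0 < p₀ → ∃ ε₁ : ℝ, 0 < ε₁ ∧ ∀ (ε₀ : ℝ), 0 < ε₀ → ε₀ ≤ ε₁ →
    ∃ γ₁ : ℝ, 0 < γ₁ ∧ ∃ κ : ℝ, 0 < κ ∧ ∀ (F : T3Family) (γ : ℝ), F.L = L → 0 < γ → γ ≤ γ₁ →
      ∃ (φ : ℕ → ℝ), (∀ J, 0 ≤ φ J) ∧ Tendsto (fun J : ℕ => (J : ℝ) * φ J) atTop (𝓝 0) ∧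
        ∀ (ν : ℕ → (j : ℕ) → Measure (GaugeField (F.P j) 0 (Matrix.specialUnitaryGroup (Fin 2) ℂ))),
          (∀ K, ν K K = T4GenFunBounds.gibbsMeasure (F.P K) ((F.scheme ℰp γ).β K)) →
          (∀ K j, j < K → ν K j = Measure.map (descend F ℰp j) (ν K (j + 1))) →
          ∀ (J K : ℕ) (hJK : J ≤ K) (ρ : GaugeField (F.P J) 0 (Matrix.specialUnitaryGroup (Fin 2) ℂ) → ℝ),
            (∀ U, PlaqSmall (θBal F.L γ b₀ p₀ J) U → 0 < ρ U) →
            ν K J = (fieldMeasure _ _ _).withDensity (fun U => ENNReal.ofReal (ρ U)) →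
            ContinuousOn ρ {U | PlaqSmall (θBal F.L γ b₀ p₀ J) U} →
            ∀ (b b' : PBond (F.P J) 0) (U V W Z : GaugeField (F.P J) 0 (Matrix.specialUnitaryGroup (Fin 2) ℂ)),
              PlaqSmall (θBal F.L γ b₀ p₀ J) U → PlaqSmall (θBal F.L γ b₀ p₀ J) V →
              PlaqSmall (θBal F.L γ b₀ p₀ J) W → PlaqSmall (θBal F.L γ b₀ p₀ J) Z →
              (∀ e, e ≠ b → U e = V e) → (∀ e, e ≠ b' → U e = W e) → (∀ e, e ≠ b' → V e = Z e) → (∀ e, e ≠ b → W e = Z e) →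
              |((Real.log (ρ U) + (F.scheme ℰp γ).β K * minActionRegPr F J K hJK ε₀ U)
                  - (Real.log (ρ V) + (F.scheme ℰp γ).β K * minActionRegPr F J K hJK ε₀ V))
                - ((Real.log (ρ W) + (F.scheme ℰp γ).β K * minActionRegPr F J K hJK ε₀ W)
                  - (Real.log (ρ Z) + (F.scheme ℰp γ).β K * minActionRegPr F J K hJK ε₀ Z))|
                ≤ φ J * Real.exp (-(κ * (b.src.tdist b'.src : ℝ)))


/-- **1L4ᶜ∘ · ONE-LOOP 4-POINTS EXIST AND ARE CLUSTERED — INTERIOR WINDOW.** Registry v11.2a's `OneLoopClusteredCan` with `∃ c₀ : ℝ, 0 < c₀ ∧ c₀ ≤ 1 ∧ ∀ (c : ℝ),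
0 < c → c ≤ c₀ →` inserted after `∀ (L : ℕ),` and every WINDOW clause `PlaqSmall (θBal F.L γ b₀ p₀ J) ·` (the regular-set inclusion (R), the positivity
(P), the four quadrilateral data of (T)) read at `θBal F.L γ (c * b₀) p₀ J`; the HISTORY `histGood F ℰp (θBal F.L γ b₀ p₀) K J` inside `heightDensity(Can)`,
`fluctAtCan`, `oneLoopFourPtCan` UNCHANGED.  Why it might fail: as 1L4ᶜ (the semiclassical limit (T) needs the fibre minimiser inside the history — now
granted by the choice of `c(L)`, R3-FLIN: `c(3) < 0.61` in the toy); (R) is honest analytic content. [cite: Balaban1985Variational, Thm 1 (8)-(10) p.279;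
Balaban1985Averaging, (10) p.19; King1986, Prop. 3.8-3.9] -/
def OneLoopClusteredIntCan : Prop :=
  ∀ (L : ℕ), ∃ c₀ : ℝ, 0 < c₀ ∧ c₀ ≤ 1 ∧ ∀ (c : ℝ), 0 < c → c ≤ c₀ → ∃ pS : ℝ, ∀ (b₀ p₀ : ℝ), 0 < b₀ → pS ≤ p₀ → 0 < p₀ → ∃ ε₁ : ℝ, 0 < ε₁ ∧ ∀ (ε₀ : ℝ), 0 < ε₀ → ε₀ ≤ ε₁ →
    ∃ γ₁ : ℝ, 0 < γ₁ ∧ ∃ κ : ℝ, 0 < κ ∧ ∀ (F : T3Family) (γ : ℝ), F.L = L → 0 < γ → γ ≤ γ₁ →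
      ∃ φ₁ : ℕ → ℝ, (∀ J, 0 ≤ φ₁ J) ∧ Tendsto (fun J : ℕ => (J : ℝ) * φ₁ J) atTop (𝓝 0) ∧
        ∀ (J K : ℕ) (hJK : J ≤ K),
          (∀ lam : ℝ, 1 ≤ lam →
            {U : GaugeField (F.P J) 0 (Matrix.specialUnitaryGroup (Fin 2) ℂ) | PlaqSmall (θBal F.L γ (c * b₀) p₀ J) U} ⊆
              Node00.regSet (fieldMeasure (F.P J) 0 (Matrix.specialUnitaryGroup (Fin 2) ℂ))
                (heightDensity F (γ / lam) hJK (histGood F ℰp (θBal F.L γ b₀ p₀) K J))) ∧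
          (∀ lam : ℝ, 1 ≤ lam → ∀ U : GaugeField (F.P J) 0 (Matrix.specialUnitaryGroup (Fin 2) ℂ), PlaqSmall (θBal F.L γ (c * b₀) p₀ J) U →
              0 < heightDensityCan F (γ / lam) hJK (histGood F ℰp (θBal F.L γ b₀ p₀) K J) U) ∧
          ∀ (b b' : PBond (F.P J) 0) (U V W Z : GaugeField (F.P J) 0 (Matrix.specialUnitaryGroup (Fin 2) ℂ)),
            PlaqSmall (θBal F.L γ (c * b₀) p₀ J) U → PlaqSmall (θBal F.L γ (c * b₀) p₀ J) V →
            PlaqSmall (θBal F.L γ (c * b₀) p₀ J) W → PlaqSmall (θBal F.L γ (c * b₀) p₀ J) Z →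
            (∀ e, e ≠ b → U e = V e) → (∀ e, e ≠ b' → U e = W e) → (∀ e, e ≠ b' → V e = Z e) → (∀ e, e ≠ b → W e = Z e) →
            Tendsto (fun lam : ℝ => fourPt (fluctAtCan F γ b₀ p₀ ε₀ hJK lam) U V W Z) atTop
                (𝓝 (oneLoopFourPtCan F γ b₀ p₀ ε₀ hJK U V W Z)) ∧
              |oneLoopFourPtCan F γ b₀ p₀ ε₀ hJK U V W Z| ≤ φ₁ J * Real.exp (-(κ * (b.src.tdist b'.src : ℝ)))

/-- **H4ᶜ∘ · BEYOND ONE LOOP — INTERIOR WINDOW.** Registry v11.2a's `BeyondOneLoopSmallCan` with the same two textual moves (shared-shape fraction after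
`∀ L`; the four quadrilateral window clauses at `c * b₀`; `fluctAtCan`∕`oneLoopFourPtCan` keep the history profile `b₀`).  Why it might fail: on interior data
the `λ = 1` vs `λ = ∞` difference is a genuine two-loop remainder `O(g_K²)` per localisation — Bałaban's (45)–(47); at small `L` only for `c ≤ c(L)`.
[cite: Balaban1985UV3, (45)-(47) p.267; Balaban1987RG1, Thm 1 (0.19)-(0.26)] -/
def BeyondOneLoopSmallIntCan : Prop :=
  ∀ (L : ℕ), ∃ c₀ : ℝ, 0 < c₀ ∧ c₀ ≤ 1 ∧ ∀ (c : ℝ), 0 < c → c ≤ c₀ → ∃ pS : ℝ, ∀ (b₀ p₀ : ℝ), 0 < b₀ → pS ≤ p₀ → 0 < p₀ → ∃ ε₁ : ℝ, 0 < ε₁ ∧ ∀ (ε₀ : ℝ), 0 < ε₀ → ε₀ ≤ ε₁ →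
    ∃ γ₁ : ℝ, 0 < γ₁ ∧ ∃ κ : ℝ, 0 < κ ∧ ∀ (F : T3Family) (γ : ℝ), F.L = L → 0 < γ → γ ≤ γ₁ →
      ∃ φ₂ : ℕ → ℝ, (∀ J, 0 ≤ φ₂ J) ∧ Tendsto (fun J : ℕ => (J : ℝ) * φ₂ J) atTop (𝓝 0) ∧
        ∀ (J K : ℕ) (hJK : J ≤ K) (b b' : PBond (F.P J) 0) (U V W Z : GaugeField (F.P J) 0 (Matrix.specialUnitaryGroup (Fin 2) ℂ)),
          PlaqSmall (θBal F.L γ (c * b₀) p₀ J) U → PlaqSmall (θBal F.L γ (c * b₀) p₀ J) V →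
          PlaqSmall (θBal F.L γ (c * b₀) p₀ J) W → PlaqSmall (θBal F.L γ (c * b₀) p₀ J) Z →
          (∀ e, e ≠ b → U e = V e) → (∀ e, e ≠ b' → U e = W e) → (∀ e, e ≠ b' → V e = Z e) → (∀ e, e ≠ b → W e = Z e) →
          |fourPt (fluctAtCan F γ b₀ p₀ ε₀ hJK 1) U V W Z - oneLoopFourPtCan F γ b₀ p₀ ε₀ hJK U V W Z|
            ≤ φ₂ J * Real.exp (-(κ * (b.src.tdist b'.src : ℝ)))

/-- **LFR♯ᶜ∘ · LARGE-FIELD 4-POINT REMAINDER — INTERIOR WINDOW.** Registry v11.2a's `LargeFieldFourPtCan` with the same two textual moves: the version `ρ`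
is positive and continuous on the INTERIOR window `{PlaqSmall (θBal F.L γ (c * b₀) p₀ J)}`, the canonical `hist(b₀)` density is positive there, and the
connected 4-points of `log ρ − log heightDensityCan^{histGood(b₀)}` at INTERIOR quadrilaterals are `≤ ψ J e^{−κ d}`.  Why it might fail: the large-field
polymer expansion's smallness per history cell is print ([Balaban1988Convergent] §2) but its 4-point clustering across `∂BL_J` is exactly what the full-window
row got wrong at `L = 3`; on the `c`-interior the boundary layer is excised by the choice of `c(L)`. [cite: Balaban1988Convergent, §2 (2.18)-(2.27);
Balaban1989LargeFieldI, §1; King1986, Prop. 3.8-3.9] -/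
def LargeFieldFourPtIntCan : Prop :=
  ∀ (L : ℕ), ∃ c₀ : ℝ, 0 < c₀ ∧ c₀ ≤ 1 ∧ ∀ (c : ℝ), 0 < c → c ≤ c₀ → ∃ pS : ℝ, ∀ (b₀ p₀ : ℝ), 0 < b₀ → pS ≤ p₀ → 0 < p₀ →
    ∃ γ₁ : ℝ, 0 < γ₁ ∧ ∃ κ : ℝ, 0 < κ ∧ ∀ (F : T3Family) (γ : ℝ), F.L = L → 0 < γ → γ ≤ γ₁ →
      ∃ ψ : ℕ → ℝ, (∀ J, 0 ≤ ψ J) ∧ Tendsto (fun J : ℕ => (J : ℝ) * ψ J) atTop (𝓝 0) ∧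
        ∀ (ν : ℕ → (j : ℕ) → Measure (GaugeField (F.P j) 0 (Matrix.specialUnitaryGroup (Fin 2) ℂ))),
          (∀ K, ν K K = T4GenFunBounds.gibbsMeasure (F.P K) ((F.scheme ℰp γ).β K)) →
          (∀ K j, j < K → ν K j = Measure.map (descend F ℰp j) (ν K (j + 1))) →
          ∀ (J K : ℕ) (hJK : J ≤ K) (ρ : GaugeField (F.P J) 0 (Matrix.specialUnitaryGroup (Fin 2) ℂ) → ℝ),
            (∀ U, PlaqSmall (θBal F.L γ (c * b₀) p₀ J) U → 0 < ρ U) →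
            ν K J = (fieldMeasure _ _ _).withDensity (fun U => ENNReal.ofReal (ρ U)) →
            ContinuousOn ρ {U | PlaqSmall (θBal F.L γ (c * b₀) p₀ J) U} →
            (∀ U : GaugeField (F.P J) 0 (Matrix.specialUnitaryGroup (Fin 2) ℂ), PlaqSmall (θBal F.L γ (c * b₀) p₀ J) U →
                0 < heightDensityCan F γ hJK (histGood F ℰp (θBal F.L γ b₀ p₀) K J) U) →
            ∀ (b b' : PBond (F.P J) 0) (U V W Z : GaugeField (F.P J) 0 (Matrix.specialUnitaryGroup (Fin 2) ℂ)),
              PlaqSmall (θBal F.L γ (c * b₀) p₀ J) U → PlaqSmall (θBal F.L γ (c * b₀) p₀ J) V →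
              PlaqSmall (θBal F.L γ (c * b₀) p₀ J) W → PlaqSmall (θBal F.L γ (c * b₀) p₀ J) Z →
              (∀ e, e ≠ b → U e = V e) → (∀ e, e ≠ b' → U e = W e) → (∀ e, e ≠ b' → V e = Z e) → (∀ e, e ≠ b → W e = Z e) →
              |fourPt (fun U => Real.log (ρ U) - Real.log (heightDensityCan F γ hJK (histGood F ℰp (θBal F.L γ b₀ p₀) K J) U)) U V W Z|
                ≤ ψ J * Real.exp (-(κ * (b.src.tdist b'.src : ℝ)))

/-- The interior table's sufficiency as ONE named proposition (its zero-hypothesis instance `fluctuationPartSmall_of_stubs` is the UNIQUE theorem of this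
file concluding `FluctuationPartSmall` by name). [cite: Balaban1985UV3, (41) p.266] -/
def TableIntSuffices : Prop := OneLoopClusteredIntCan → BeyondOneLoopSmallIntCan → LargeFieldFourPtIntCan → FluctuationPartSmall

/-! ## §3 PROVED: 1L4ᶜ∘ → H4ᶜ∘ → LFR♯ᶜ∘ → S2β — the common fraction `c := min c₀ᵢ` and the `b₀ ∕ c` instantiation, then v11.2a's composition verbatim -/

/-- **COMPOSITION · 1L4ᶜ∘ → H4ᶜ∘ → LFR♯ᶜ∘ → S2β (PROVED)**: common `c`, rows read at history profile `b₀ ∕ c` (interior window `c · (b₀ ∕ c) = b₀` = S2β's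
window), then `log ρ + β_K S = f¹ + (log ρ − log g)` with `g = heightDensityCan^{histGood(b₀∕c)}`, `|Δ²f¹| ≤ |Λ₄| + |Δ²f¹ − Λ₄|`, `κ := min`, `φ := φ₁ + φ₂ + ψ`.
[cite: Balaban1985UV3, (41) p.266; Balaban1985Variational, Thm 1 (8) p.279] -/
theorem fluctuationPartSmall_of_interiorTable : TableIntSuffices := by
  intro h1 h2 h3 L
  obtain ⟨c₁, hc₁, hc₁1, H1⟩ := h1 L
  obtain ⟨c₂, hc₂, -, H2⟩ := h2 L
  obtain ⟨c₃, hc₃, -, H3⟩ := h3 L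
  -- ONE COMMON WINDOW FRACTION `c := min c₁ c₂ c₃` for the three rows (the rows hold for every `c ≤ c₀`, so the minimum serves all three).
  obtain ⟨c, hc, hcle₁, hcle₂, hcle₃⟩ : ∃ c : ℝ, 0 < c ∧ c ≤ c₁ ∧ c ≤ c₂ ∧ c ≤ c₃ :=
    ⟨min c₁ (min c₂ c₃), lt_min hc₁ (lt_min hc₂ hc₃), min_le_left _ _, (min_le_right _ _).trans (min_le_left _ _),
      (min_le_right _ _).trans (min_le_right _ _)⟩
  obtain ⟨pS₁, H1⟩ := H1 c hc hcle₁
  obtain ⟨pS₂, H2⟩ := H2 c hc hcle₂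
  obtain ⟨pS₃, H3⟩ := H3 c hc hcle₃
  refine ⟨max pS₁ (max pS₂ pS₃), fun b₀ p₀ hb hpS hp => ?_⟩
  -- THE `b₀ ∕ c` INSTANTIATION: the rows are read at history profile `b₀ ∕ c`, whose interior window `c · (b₀ ∕ c) = b₀` IS S2β's window.
  have hb' : 0 < b₀ / c := div_pos hb hc
  have e : c * (b₀ / c) = b₀ := mul_div_cancel₀ b₀ hc.ne'
  have hp1 : pS₁ ≤ p₀ := (le_max_left _ _).trans hpS
  have hp2 : pS₂ ≤ p₀ := ((le_max_left _ _).trans (le_max_right _ _)).trans hpS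
  have hp3 : pS₃ ≤ p₀ := ((le_max_right _ _).trans (le_max_right _ _)).trans hpS
  obtain ⟨ε₁, hε₁, H1⟩ := H1 (b₀ / c) p₀ hb' hp1 hp
  obtain ⟨ε₂, hε₂, H2⟩ := H2 (b₀ / c) p₀ hb' hp2 hp
  obtain ⟨γ₃, hγ₃, κ₃, hκ₃, H3⟩ := H3 (b₀ / c) p₀ hb' hp3 hp
  refine ⟨min ε₁ ε₂, lt_min hε₁ hε₂, fun ε₀ hε₀ hε₀1 => ?_⟩
  obtain ⟨γ₁, hγ₁, κ₁, hκ₁, H1⟩ := H1 ε₀ hε₀ (hε₀1.trans (min_le_left _ _))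
  obtain ⟨γ₂, hγ₂, κ₂, hκ₂, H2⟩ := H2 ε₀ hε₀ (hε₀1.trans (min_le_right _ _))
  refine ⟨min γ₁ (min γ₂ γ₃), lt_min hγ₁ (lt_min hγ₂ hγ₃), min κ₁ (min κ₂ κ₃), lt_min hκ₁ (lt_min hκ₂ hκ₃),
    fun F γ hFL hγ hγle => ?_⟩
  obtain ⟨φ₁, hφ₁0, hφ₁t, H1⟩ := H1 F γ hFL hγ (hγle.trans (min_le_left _ _))
  obtain ⟨φ₂, hφ₂0, hφ₂t, H2⟩ := H2 F γ hFL hγ (hγle.trans ((min_le_right _ _).trans (min_le_left _ _)))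
  obtain ⟨ψ, hψ0, hψt, H3⟩ := H3 F γ hFL hγ (hγle.trans ((min_le_right _ _).trans (min_le_right _ _)))
  -- rewrite the rows' interior window `θBal F.L γ (c * (b₀ / c)) p₀ J` to S2β's window `θBal F.L γ b₀ p₀ J`
  simp only [e] at H1 H2 H3
  refine ⟨fun J => φ₁ J + φ₂ J + ψ J, fun J => ?_, ?_, ?_⟩
  · have := hφ₁0 J; have := hφ₂0 J; have := hψ0 J; positivity
  · have h := (hφ₁t.add hφ₂t).add hψt
    rw [add_zero, add_zero] at h
    refine h.congr' (Eventually.of_forall fun J => ?_)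
    show (J : ℝ) * φ₁ J + (J : ℝ) * φ₂ J + (J : ℝ) * ψ J = (J : ℝ) * (φ₁ J + φ₂ J + ψ J)
    ring
  · intro ν hνK hνd J K hJK ρ hρpos hνρ hρcont b b' U V W Z hU hV hW hZ hUV hUW hVZ hWZ
    obtain ⟨-, hgposAll, H1q⟩ := H1 J K hJK
    have hgpos : ∀ U : GaugeField (F.P J) 0 (Matrix.specialUnitaryGroup (Fin 2) ℂ), PlaqSmall (θBal F.L γ b₀ p₀ J) U →
        0 < heightDensityCan F γ hJK (histGood F ℰp (θBal F.L γ (b₀ / c) p₀) K J) U := by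
      intro U hU
      have := hgposAll 1 le_rfl U hU
      simpa only [div_one] using this
    obtain ⟨-, hΛ⟩ := H1q b b' U V W Z hU hV hW hZ hUV hUW hVZ hWZ
    have hq := H2 J K hJK b b' U V W Z hU hV hW hZ hUV hUW hVZ hWZ
    have hl := H3 ν hνK hνd J K hJK ρ hρpos hνρ hρcont hgpos b b' U V W Z hU hV hW hZ hUV hUW hVZ hWZ
    set g : GaugeField (F.P J) 0 (Matrix.specialUnitaryGroup (Fin 2) ℂ) → ℝ :=
      fun U => heightDensityCan F γ hJK (histGood F ℰp (θBal F.L γ (b₀ / c) p₀) K J) U with hg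
    set B : GaugeField (F.P J) 0 (Matrix.specialUnitaryGroup (Fin 2) ℂ) → ℝ :=
      fun U => (F.scheme ℰp γ).β K * minActionRegPr F J K hJK ε₀ U with hB
    set Λ : ℝ := oneLoopFourPtCan F γ (b₀ / c) p₀ ε₀ hJK U V W Z with hΛdef
    set d : ℝ := (b.src.tdist b'.src : ℝ) with hd
    have hd0 : 0 ≤ d := by rw [hd]; exact Nat.cast_nonneg _
    have hf1 : fourPt (fluctAtCan F γ (b₀ / c) p₀ ε₀ hJK 1) U V W Z
        = ((Real.log (g U) + B U) - (Real.log (g V) + B V)) - ((Real.log (g W) + B W) - (Real.log (g Z) + B Z)) := by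
      simp only [fourPt, fluctAtCan_one, hg, hB]
    have hsplit : ((Real.log (ρ U) + B U) - (Real.log (ρ V) + B V)) - ((Real.log (ρ W) + B W) - (Real.log (ρ Z) + B Z))
        = fourPt (fluctAtCan F γ (b₀ / c) p₀ ε₀ hJK 1) U V W Z
          + fourPt (fun U => Real.log (ρ U) - Real.log (g U)) U V W Z := by
      rw [hf1]; simp only [fourPt]; ring
    have e1 : Real.exp (-(κ₁ * d)) ≤ Real.exp (-(min κ₁ (min κ₂ κ₃) * d)) :=
      Real.exp_le_exp.mpr (neg_le_neg (mul_le_mul_of_nonneg_right (min_le_left κ₁ (min κ₂ κ₃)) hd0))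
    have e2 : Real.exp (-(κ₂ * d)) ≤ Real.exp (-(min κ₁ (min κ₂ κ₃) * d)) :=
      Real.exp_le_exp.mpr (neg_le_neg (mul_le_mul_of_nonneg_right ((min_le_right κ₁ (min κ₂ κ₃)).trans (min_le_left κ₂ κ₃)) hd0))
    have e3 : Real.exp (-(κ₃ * d)) ≤ Real.exp (-(min κ₁ (min κ₂ κ₃) * d)) :=
      Real.exp_le_exp.mpr (neg_le_neg (mul_le_mul_of_nonneg_right ((min_le_right κ₁ (min κ₂ κ₃)).trans (min_le_right κ₂ κ₃)) hd0))
    have hφ₁J := hφ₁0 J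
    have hφ₂J := hφ₂0 J
    have hψJ := hψ0 J
    have htri : |fourPt (fluctAtCan F γ (b₀ / c) p₀ ε₀ hJK 1) U V W Z| ≤ |Λ| + |fourPt (fluctAtCan F γ (b₀ / c) p₀ ε₀ hJK 1) U V W Z - Λ| := by
      have := abs_add_le Λ (fourPt (fluctAtCan F γ (b₀ / c) p₀ ε₀ hJK 1) U V W Z - Λ)
      simpa only [add_sub_cancel] using this
    show |((Real.log (ρ U) + B U) - (Real.log (ρ V) + B V)) - ((Real.log (ρ W) + B W) - (Real.log (ρ Z) + B Z))|
        ≤ (φ₁ J + φ₂ J + ψ J) * Real.exp (-(min κ₁ (min κ₂ κ₃) * d))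
    rw [hsplit]
    refine (abs_add_le _ _).trans ?_
    calc |fourPt (fluctAtCan F γ (b₀ / c) p₀ ε₀ hJK 1) U V W Z| + |fourPt (fun U => Real.log (ρ U) - Real.log (g U)) U V W Z|
        ≤ (|Λ| + |fourPt (fluctAtCan F γ (b₀ / c) p₀ ε₀ hJK 1) U V W Z - Λ|) + ψ J * Real.exp (-(κ₃ * d)) := add_le_add htri hl
      _ ≤ (φ₁ J * Real.exp (-(κ₁ * d)) + φ₂ J * Real.exp (-(κ₂ * d))) + ψ J * Real.exp (-(κ₃ * d)) :=
          add_le_add (add_le_add hΛ hq) le_rfl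
      _ ≤ (φ₁ J * Real.exp (-(min κ₁ (min κ₂ κ₃) * d)) + φ₂ J * Real.exp (-(min κ₁ (min κ₂ κ₃) * d)))
            + ψ J * Real.exp (-(min κ₁ (min κ₂ κ₃) * d)) := by
          gcongr
      _ = (φ₁ J + φ₂ J + ψ J) * Real.exp (-(min κ₁ (min κ₂ κ₃) * d)) := by ring

end Rows


/-! ## §4 Stubs (the ∘-rows' sorries) and the S2β this file delivers -/

section Stubs

/-- STUB 1L4ᶜ∘ (interior-window one-loop clustering; shared-shape fraction). [cite: Balaban1985Variational, Thm 1 (8)-(10) p.279] -/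
theorem stub_oneLoopClusteredIntCan : OneLoopClusteredIntCan := by
  sorry

/-- STUB H4ᶜ∘ (interior-window beyond-one-loop remainder). [cite: Balaban1985UV3, (45)-(47) p.267] -/
theorem stub_beyondOneLoopSmallIntCan : BeyondOneLoopSmallIntCan := by
  sorry

/-- STUB LFR♯ᶜ∘ (interior-window large-field 4-point remainder). [cite: Balaban1988Convergent, §2 (2.18)-(2.27)] -/
theorem stub_largeFieldFourPtIntCan : LargeFieldFourPtIntCan := by
  sorry

/-- **THE S2β THIS FILE DELIVERS** (zero hypotheses; the unique by-name concluder of `FluctuationPartSmall` here). [cite: Balaban1985UV3, (41) p.266] -/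
theorem fluctuationPartSmall_of_stubs : FluctuationPartSmall :=
  fluctuationPartSmall_of_interiorTable stub_oneLoopClusteredIntCan stub_beyondOneLoopSmallIntCan stub_largeFieldFourPtIntCan

end Stubs

end Summit.QuantumFields.YangMills.Cruxes.FluctuationComparisonRegPrIntL.RunPairOrgan.InteriorTable

end
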